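import Mathlib.Analysis.Distribution.AEEqOfIntegralContDiff
import Mathlib.Analysis.InnerProductSpace.PiL2
import Mathlib.MeasureTheory.Function.L2Space
import Mathlib.MeasureTheory.Integral.MeanInequalities
import Literature.Analysis.FunctionSpaces.TestFunctionDensity
import HarnessLib

/-!
# Pairings of vector fields with test fields: du Bois-Reymond, `L³` bounds by duality, dilations

Analysis/FunctionSpaces support file (all results proved, [folklore]) for the limiting
procedure in Seregin's `L³` blow-up criterion (`FluidPDE/NSSereginMildCore`: the blow-up profile
`u(T)` is an `L³` field because it is the distributional limit of slices with `‖u(T_n)‖₃ ≤ M`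
— Lemarié-Rieusset 2016, p. 573: "`u(1,.)` is the limit … of `u(T_{n_k},.)` with
`‖u(T_{n_k},.)‖₃ ≤ M`; thus `u(1,.) ∈ L³`"; and the rescaled profiles `λ u(T)(λ ·)` tend to `0`
in the sense of distributions as `λ → 0` — ibid.: "this limit is equal to `0` since
`u(1,.) ∈ L³`"). Generic statements, for vector fields `f : E → E` on a finite-dimensional real
inner product space with its Lebesgue (Haar) measure, paired with smooth compactly supported
test fields `φ` (`IsTestFunctionOn ⊤ φ`) through `∫ ⟪f, φ⟫`:

* `ae_eq_zero_of_forall_integral_inner_test_eq_zero` — **du Bois-Reymond for vector fields**: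
  a locally integrable field annihilating every test field vanishes a.e. (componentwise, Mathlib's
  `ae_eq_zero_of_integral_contDiff_smul_eq_zero`); `ae_eq_of_forall_integral_inner_test_eq`.
* `memLp_three_of_forall_abs_integral_inner_le` — **`L³` by duality**: if `f ∈ L²_loc` and
  `|∫⟪f, φ⟫| ≤ M ‖φ‖_{3/2}` for all test fields, then `f ∈ L³` with `‖f‖₃ ≤ M` (density of test
  fields in `L²` of a ball, `TestFunctionDensity`, then the test field `|g| g` for the
  truncations `g = 𝟙_{|x| ≤ k, |f| ≤ k} f` and monotone convergence; Brezis 2011, Prop. 4.?? is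
  the reflexive-space statement, here proved bare-handed).
* `tendsto_integral_inner_dilate_of_memLp_three` — **dilations of an `L³` field vanish in
  `𝒟'`**: in dimension `3`, `∫ ⟪c • f(c • x − a), φ(x)⟫ dx → 0` as `c → 0⁺` (change of
  variables, Hölder with exponents `(3, 3/2)` — both sides are scale invariant — and absolute
  continuity of `∫ |f|³` on shrinking balls).
* `ae_eq_uncurry_of_forall_mem_slice_ae` — slice-wise a.e. equality of jointly measurable
  space–time fields on `I × E` is a.e. equality on `I × E` (Tonelli).

## References

* H. Brezis, *Functional Analysis, Sobolev Spaces and PDE* (2011), Cor. 4.24 (du Bois-Reymond),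
  Prop. 3.5 (iii) and Thm. 4.10 (weak lower semicontinuity / duality in `L^p`).
* P. G. Lemarié-Rieusset, *The Navier–Stokes Problem in the 21st Century* (2016), p. 573.
-/

noncomputable section

open MeasureTheory TopologicalSpace Set Function Filter Metric
open _root_.Topology
open scoped ENNReal NNReal RealInnerProductSpace

namespace Literature.Analysis.FunctionSpaces

variable {E : Type*} [NormedAddCommGroup E] [InnerProductSpace ℝ E] [FiniteDimensional ℝ E]
  [MeasurableSpace E] [BorelSpace E]

/-! ### du Bois-Reymond for vector fields -/

omit [FiniteDimensional ℝ E] [MeasurableSpace E] [BorelSpace E] in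
/-- A scalar test function times a fixed vector is a (vector) test field. [folklore] -/
theorem isTestFunctionOn_smul_const {g : E → ℝ} (hg : ContDiff ℝ (⊤ : ℕ∞) g)
    (hgc : HasCompactSupport g) (e : E) :
    IsTestFunctionOn (⊤ : Opens E) (fun x => g x • e) where
  contDiff := hg.smul contDiff_const
  hasCompactSupport := hgc.smul_right
  tsupport_subset := fun _ _ => trivial

/-- **du Bois-Reymond lemma for vector fields.** A locally integrable vector field `f : E → E`
with `∫ ⟪f, φ⟫ = 0` for every smooth compactly supported field `φ` vanishes a.e. (test with
`φ = g • e`, `g` scalar, `e` a basis vector, and apply the scalar lemma to `⟪f, e⟫`;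
Brezis 2011, Cor. 4.24). [folklore] -/
theorem ae_eq_zero_of_forall_integral_inner_test_eq_zero {f : E → E}
    (hf : LocallyIntegrable f volume)
    (h : ∀ φ : E → E, IsTestFunctionOn (⊤ : Opens E) φ → ∫ x, ⟪f x, φ x⟫ = 0) :
    f =ᵐ[volume] 0 := by
  -- every component `⟪f, e⟫` vanishes a.e.
  have hcomp : ∀ e : E, (fun x => ⟪f x, e⟫) =ᵐ[volume] 0 := by
    intro e
    have hloc : LocallyIntegrable (fun x => ⟪f x, e⟫) volume := by
      rw [locallyIntegrable_iff] at hf ⊢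
      exact fun K hK => (hf K hK).inner_const e
    refine ae_eq_zero_of_integral_contDiff_smul_eq_zero hloc fun g hg hgc => ?_
    have h1 := h (fun x => g x • e) (isTestFunctionOn_smul_const hg hgc e)
    have h2 : (fun x => g x • ⟪f x, e⟫) = fun x => ⟪f x, g x • e⟫ := by
      funext x
      rw [inner_smul_right, smul_eq_mul]
    rw [h2]
    exact h1
  -- hence `f = 0` a.e. (expand in an orthonormal basis)
  set b := stdOrthonormalBasis ℝ E with hb
  have hall : ∀ᵐ x ∂(volume : Measure E), ∀ i, ⟪f x, b i⟫ = 0 := by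
    rw [ae_all_iff]
    intro i
    filter_upwards [hcomp (b i)] with x hx
    simpa using hx
  filter_upwards [hall] with x hx
  rw [Pi.zero_apply, ← b.sum_repr' (f x)]
  simp only [fun i => show ⟪b i, f x⟫ = 0 by rw [real_inner_comm]; exact hx i, zero_smul,
    Finset.sum_const_zero]

/-- Two locally integrable vector fields with the same pairings against all smooth compactly
supported fields agree a.e. [folklore] -/
theorem ae_eq_of_forall_integral_inner_test_eq {f g : E → E} (hf : LocallyIntegrable f volume)
    (hg : LocallyIntegrable g volume)
    (h : ∀ φ : E → E, IsTestFunctionOn (⊤ : Opens E) φ →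
      ∫ x, ⟪f x, φ x⟫ = ∫ x, ⟪g x, φ x⟫) :
    f =ᵐ[volume] g := by
  have hsub : (f - g) =ᵐ[volume] 0 := by
    refine ae_eq_zero_of_forall_integral_inner_test_eq_zero (hf.sub hg) fun φ hφ => ?_
    have hif := integrable_inner_of_locallyIntegrable_test hf hφ
    have hig := integrable_inner_of_locallyIntegrable_test hg hφ
    simp only [Pi.sub_apply, inner_sub_left]
    rw [integral_sub hif hig, h φ hφ, sub_self]
  filter_upwards [hsub] with x hx
  simpa [sub_eq_zero] using hx
where
  /-- pairings with test fields converge absolutely -/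
  integrable_inner_of_locallyIntegrable_test {u : E → E} (hu : LocallyIntegrable u volume)
      {φ : E → E} (hφ : IsTestFunctionOn (⊤ : Opens E) φ) :
      Integrable (fun x => ⟪u x, φ x⟫) volume := by
    obtain ⟨C, hC⟩ := hφ.contDiff.continuous.bounded_above_of_compact_support hφ.hasCompactSupport
    have hsupp : support (fun x => ⟪u x, φ x⟫) ⊆ tsupport φ := fun x hx => by
      by_contra hx'
      exact hx (by simp [image_eq_zero_of_notMem_tsupport hx'])
    rw [← integrableOn_iff_integrable_of_support_subset hsupp]
    have hK : IntegrableOn u (tsupport φ) volume := hu.integrableOn_isCompact hφ.hasCompactSupport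
    refine Integrable.mono' (hK.norm.mul_const C)
      (hK.aestronglyMeasurable.inner hφ.contDiff.continuous.aestronglyMeasurable.restrict)
      (Eventually.of_forall fun x => ?_)
    calc ‖⟪u x, φ x⟫‖ ≤ ‖u x‖ * ‖φ x‖ := norm_inner_le_norm _ _
      _ ≤ ‖u x‖ * C := by gcongr; exact hC x

/-! ### Slice-wise and space–time a.e. equality -/

/-- **Slice-wise a.e. equality of measurable space–time fields is space–time a.e. equality.**
If `u`, `u'` are (a.e. strongly) measurable on `I × E` for a measurable set of times `I` and
`u(t) = u'(t)` a.e. for every `t ∈ I`, then `u = u'` a.e. on `I × E` (Tonelli for the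
measurable set `{u ≠ u'}` of measurable representatives). [folklore] -/
theorem ae_eq_uncurry_of_forall_mem_slice_ae {F : Type*} [NormedAddCommGroup F]
    {I : Set ℝ} (hI : MeasurableSet I) {u u' : ℝ → E → F}
    (hu : AEStronglyMeasurable (uncurry u) ((volume : Measure (ℝ × E)).restrict (I ×ˢ univ)))
    (hu' : AEStronglyMeasurable (uncurry u') ((volume : Measure (ℝ × E)).restrict (I ×ˢ univ)))
    (h : ∀ t ∈ I, u t =ᵐ[volume] u' t) :
    uncurry u =ᵐ[(volume : Measure (ℝ × E)).restrict (I ×ˢ univ)] uncurry u' := by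
  have hprod : (volume : Measure (ℝ × E)).restrict (I ×ˢ univ) =
      ((volume : Measure ℝ).restrict I).prod (volume : Measure E) := by
    rw [Measure.volume_eq_prod, ← Measure.restrict_univ (μ := (volume : Measure E)),
      Measure.prod_restrict, Measure.restrict_univ]
  rw [hprod] at hu hu' ⊢
  set μ := (volume : Measure ℝ).restrict I with hμ
  set f := hu.mk (uncurry u) with hf
  set f' := hu'.mk (uncurry u') with hf'
  have hfm : StronglyMeasurable f := hu.stronglyMeasurable_mk
  have hfm' : StronglyMeasurable f' := hu'.stronglyMeasurable_mk
  have huf : uncurry u =ᵐ[μ.prod volume] f := hu.ae_eq_mk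
  have huf' : uncurry u' =ᵐ[μ.prod volume] f' := hu'.ae_eq_mk
  have h1 : ∀ᵐ t ∂μ, ∀ᵐ x ∂(volume : Measure E), uncurry u (t, x) = f (t, x) :=
    Measure.ae_ae_of_ae_prod huf
  have h2 : ∀ᵐ t ∂μ, ∀ᵐ x ∂(volume : Measure E), uncurry u' (t, x) = f' (t, x) :=
    Measure.ae_ae_of_ae_prod huf'
  have h3 : ∀ᵐ t ∂μ, u t =ᵐ[volume] u' t := by
    rw [hμ, ae_restrict_iff' hI]
    exact Eventually.of_forall fun t ht => h t ht
  have hslice : ∀ᵐ t ∂μ, (volume : Measure E) {x | f (t, x) ≠ f' (t, x)} = 0 := by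
    filter_upwards [h1, h2, h3] with t h1t h2t h3t
    have : (fun x => f (t, x)) =ᵐ[volume] fun x => f' (t, x) := by
      filter_upwards [h1t, h2t, h3t] with x hx1 hx2 hx3
      rw [← hx1, ← hx2]
      exact hx3
    exact this
  have hN : MeasurableSet {z : ℝ × E | f z ≠ f' z} := (hfm.measurableSet_eq_fun hfm').compl
  have hnull : (μ.prod (volume : Measure E)) {z : ℝ × E | f z ≠ f' z} = 0 := by
    rw [Measure.prod_apply hN]
    exact lintegral_eq_zero_of_ae_eq_zero hslice
  have hff' : f =ᵐ[μ.prod volume] f' := measure_eq_zero_iff_ae_notMem.1 hnull |>.mono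
    fun z hz => by simpa using hz
  exact huf.trans (hff'.trans huf'.symm)


/-! ### `L³` bounds by duality -/

omit [FiniteDimensional ℝ E] [BorelSpace E] in
/-- `|∫ ⟪f, g⟫| ≤ ‖f‖₂ ‖g‖₂` for `f, g ∈ L²` (Cauchy–Schwarz in `L²(μ; E)`). [folklore] -/
theorem abs_integral_inner_le_eLpNorm_two_mul {μ : Measure E} {f g : E → E} (hf : MemLp f 2 μ)
    (hg : MemLp g 2 μ) :
    |∫ x, ⟪f x, g x⟫ ∂μ| ≤ (eLpNorm f 2 μ).toReal * (eLpNorm g 2 μ).toReal := by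
  have h1 : ⟪hf.toLp f, hg.toLp g⟫ = ∫ x, ⟪f x, g x⟫ ∂μ := by
    rw [L2.inner_def]
    exact integral_congr_ae (by
      filter_upwards [hf.coeFn_toLp, hg.coeFn_toLp] with x hx hy
      rw [hx, hy])
  rw [← h1, ← Lp.norm_toLp f hf, ← Lp.norm_toLp g hg]
  exact abs_real_inner_le_norm _ _

/-- **Extension of a test-field bound to compactly supported `L²` fields.** If `f ∈ L²_loc`
(measurable with `|f|²` locally integrable) satisfies `|∫⟪f, φ⟫| ≤ M ‖φ‖_{3/2}` for all smooth
compactly supported `φ`, then the same bound holds for every `φ ∈ L²` supported in a ball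
(approximate `φ` in `L²` of the ball by test fields supported in the ball; on a ball `L²`
convergence dominates `L^{3/2}` convergence, and the pairing is `L²`-continuous). [folklore] -/
theorem abs_integral_inner_le_of_test_bound {f : E → E} (hfm : AEStronglyMeasurable f volume)
    (hf2 : LocallyIntegrable (fun x => ‖f x‖ ^ 2) volume) {M : ℝ}
    (h : ∀ φ : E → E, IsTestFunctionOn (⊤ : Opens E) φ →
      |∫ x, ⟪f x, φ x⟫| ≤ M * (eLpNorm φ (3 / 2 : ℝ≥0∞) volume).toReal)
    {φ : E → E} {R : ℝ} (hφ : MemLp φ 2 volume) (hsupp : support φ ⊆ ball (0 : E) R) :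
    |∫ x, ⟪f x, φ x⟫| ≤ M * (eLpNorm φ (3 / 2 : ℝ≥0∞) volume).toReal := by
  set q : ℝ≥0∞ := 3 / 2 with hq_def
  have hq1 : 1 ≤ q := by
    rw [hq_def, ENNReal.le_div_iff_mul_le (by norm_num) (by norm_num)]; norm_num
  have hq2 : q ≤ 2 := by
    rw [hq_def, ENNReal.div_le_iff (by norm_num) (by norm_num)]; norm_num
  have hqtop : q ≠ ∞ := by rw [hq_def]; exact ENNReal.div_ne_top (by norm_num) (by norm_num)
  -- the ball `S` and the class of `f` on it
  set S : Opens E := ⟨ball (0 : E) R, isOpen_ball⟩ with hS_def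
  have hS : (S : Set E) = ball (0 : E) R := rfl
  set μS : Measure E := volume.restrict (S : Set E) with hμS
  haveI : IsFiniteMeasure μS := ⟨by
    rw [hμS, Measure.restrict_apply_univ, hS]; exact measure_ball_lt_top⟩
  have hfS : MemLp f 2 μS := by
    refine (memLp_two_iff_integrable_sq_norm hfm.restrict).2 ?_
    have h1 : IntegrableOn (fun x => ‖f x‖ ^ 2) (closedBall (0 : E) R) volume :=
      hf2.integrableOn_isCompact (isCompact_closedBall _ _)
    exact h1.mono_set (by rw [hS]; exact ball_subset_closedBall)
  -- test fields `φ n → φ` in `L²(S)`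
  have hφS : MemLp φ 2 μS := hφ.restrict _
  obtain ⟨ψ, hψ, hψlim⟩ :=
    exists_isTestFunctionOn_tendsto_eLpNorm_sub S (μ := volume) one_le_two ENNReal.ofNat_ne_top hφS
  have hψtop : ∀ n, IsTestFunctionOn (⊤ : Opens E) (ψ n) := fun n => (hψ n).mono le_top
  have hψsupp : ∀ n, support (ψ n) ⊆ (S : Set E) := fun n =>
    (subset_tsupport _).trans (hψ n).tsupport_subset
  have hdsupp : ∀ n, support (φ - ψ n) ⊆ (S : Set E) := by
    intro n x hx
    by_contra hxS
    have h1 : φ x = 0 := by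
      by_contra h1; exact hxS (hS ▸ hsupp (mem_support.2 h1))
    have h2 : ψ n x = 0 := by
      by_contra h2; exact hxS (hψsupp n (mem_support.2 h2))
    exact hx (by simp [h1, h2])
  have hψ2 : ∀ n, MemLp (ψ n) 2 volume := fun n =>
    (hψtop n).contDiff.continuous.memLp_of_hasCompactSupport (hψtop n).hasCompactSupport
  -- (i) the pairings converge
  have hpair : Tendsto (fun n => ∫ x, ⟪f x, ψ n x⟫) atTop (𝓝 (∫ x, ⟪f x, φ x⟫)) := by
    have hint : ∀ g : E → E, MemLp g 2 volume → support g ⊆ (S : Set E) →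
        ∫ x, ⟪f x, g x⟫ = ∫ x, ⟪f x, g x⟫ ∂μS := by
      intro g _ hg
      rw [hμS, setIntegral_eq_integral_of_forall_compl_eq_zero]
      intro x hx
      have : g x = 0 := by by_contra h'; exact hx (hg (mem_support.2 h'))
      simp [this]
    have hφS' : support φ ⊆ (S : Set E) := by rw [hS]; exact hsupp
    rw [tendsto_iff_norm_sub_tendsto_zero]
    have hbound : ∀ n, ‖(∫ x, ⟪f x, ψ n x⟫) - ∫ x, ⟪f x, φ x⟫‖ ≤
        (eLpNorm f 2 μS).toReal * (eLpNorm (φ - ψ n) 2 μS).toReal := by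
      intro n
      have hd : MemLp (φ - ψ n) 2 μS := hφS.sub ((hψ2 n).restrict _)
      rw [hint (ψ n) (hψ2 n) (hψsupp n), hint φ hφ hφS', ← integral_sub
        ((integrable_inner_of_memLp_two hfS ((hψ2 n).restrict _)))
        (integrable_inner_of_memLp_two hfS hφS), Real.norm_eq_abs]
      have e : (fun x => ⟪f x, ψ n x⟫ - ⟪f x, φ x⟫) = fun x => -⟪f x, (φ - ψ n) x⟫ := by
        funext x; simp [inner_sub_right]
      rw [e, integral_neg, abs_neg]
      exact abs_integral_inner_le_eLpNorm_two_mul hfS hd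
    have hlim : Tendsto (fun n => (eLpNorm f 2 μS).toReal * (eLpNorm (φ - ψ n) 2 μS).toReal)
        atTop (𝓝 0) := by
      rw [← mul_zero (eLpNorm f 2 μS).toReal]
      refine Tendsto.const_mul _ ?_
      rw [← ENNReal.toReal_zero]
      exact (ENNReal.tendsto_toReal ENNReal.zero_ne_top).comp hψlim
    exact squeeze_zero (fun n => norm_nonneg _) hbound hlim
  -- (ii) the `L^{3/2}` norms converge
  have hnorm : Tendsto (fun n => (eLpNorm (ψ n) q volume).toReal) atTop
      (𝓝 (eLpNorm φ q volume).toReal) := by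
    -- `‖φ - ψ n‖_{3/2} ≤ ‖φ - ψ n‖_{L²(S)} |S|^{1/6} → 0`
    have hdq : Tendsto (fun n => eLpNorm (φ - ψ n) q volume) atTop (𝓝 0) := by
      have hle : ∀ n, eLpNorm (φ - ψ n) q volume ≤
          eLpNorm (φ - ψ n) 2 μS * μS univ ^ (1 / q.toReal - 1 / (2 : ℝ≥0∞).toReal) := by
        intro n
        rw [← eLpNorm_restrict_eq_of_support_subset (hdsupp n)]
        exact eLpNorm_le_eLpNorm_mul_rpow_measure_univ hq2
          ((hφ.aestronglyMeasurable.sub (hψ2 n).aestronglyMeasurable).restrict)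
      have hlim : Tendsto (fun n => eLpNorm (φ - ψ n) 2 μS *
          μS univ ^ (1 / q.toReal - 1 / (2 : ℝ≥0∞).toReal)) atTop (𝓝 0) := by
        rw [← zero_mul (μS univ ^ (1 / q.toReal - 1 / (2 : ℝ≥0∞).toReal))]
        refine ENNReal.Tendsto.mul_const hψlim (Or.inr ?_)
        exact ENNReal.rpow_ne_top_of_nonneg (by
          rw [hq_def, ENNReal.toReal_div]; norm_num) (measure_ne_top _ _)
      exact tendsto_of_tendsto_of_tendsto_of_le_of_le tendsto_const_nhds hlim
        (fun _ => bot_le) hle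
    have hφq : eLpNorm φ q volume ≠ ∞ := by
      rw [← eLpNorm_restrict_eq_of_support_subset (show support φ ⊆ (S : Set E) by
        rw [hS]; exact hsupp)]
      exact (hφS.mono_exponent hq2).eLpNorm_ne_top
    have hψq : ∀ n, eLpNorm (ψ n) q volume ≠ ∞ := fun n =>
      ((hψtop n).contDiff.continuous.memLp_of_hasCompactSupport
        (hψtop n).hasCompactSupport).eLpNorm_ne_top
    -- squeeze `|‖ψ n‖ - ‖φ‖| ≤ ‖φ - ψ n‖` in `ℝ≥0∞`
    have hENN : Tendsto (fun n => eLpNorm (ψ n) q volume) atTop (𝓝 (eLpNorm φ q volume)) := by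
      have hup : ∀ n, eLpNorm (ψ n) q volume ≤ eLpNorm φ q volume + eLpNorm (φ - ψ n) q volume := by
        intro n
        have e : ψ n = φ - (φ - ψ n) := by abel
        calc eLpNorm (ψ n) q volume = eLpNorm (φ - (φ - ψ n)) q volume := by rw [← e]
          _ ≤ eLpNorm φ q volume + eLpNorm (φ - ψ n) q volume :=
              eLpNorm_sub_le hφ.aestronglyMeasurable
                (hφ.aestronglyMeasurable.sub (hψ2 n).aestronglyMeasurable) hq1
      have hdown : ∀ n, eLpNorm φ q volume ≤ eLpNorm (ψ n) q volume + eLpNorm (φ - ψ n) q volume := by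
        intro n
        have e : φ = ψ n + (φ - ψ n) := by abel
        calc eLpNorm φ q volume = eLpNorm (ψ n + (φ - ψ n)) q volume := by rw [← e]
          _ ≤ eLpNorm (ψ n) q volume + eLpNorm (φ - ψ n) q volume :=
              eLpNorm_add_le (hψ2 n).aestronglyMeasurable
                (hφ.aestronglyMeasurable.sub (hψ2 n).aestronglyMeasurable) hq1
      have h0 : Tendsto (fun n => eLpNorm φ q volume + eLpNorm (φ - ψ n) q volume) atTop
          (𝓝 (eLpNorm φ q volume)) := by
        simpa using (tendsto_const_nhds (x := eLpNorm φ q volume)).add hdq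
      -- lower bound: `‖φ‖ - ‖φ - ψ n‖ ≤ ‖ψ n‖`
      have hlow : Tendsto (fun n => eLpNorm φ q volume - eLpNorm (φ - ψ n) q volume) atTop
          (𝓝 (eLpNorm φ q volume)) := by
        have := ENNReal.Tendsto.sub (tendsto_const_nhds (x := eLpNorm φ q volume)) hdq
          (Or.inl hφq)
        rwa [tsub_zero] at this
      exact tendsto_of_tendsto_of_tendsto_of_le_of_le hlow h0
        (fun n => tsub_le_iff_right.2 (hdown n)) hup
    exact (ENNReal.tendsto_toReal hφq).comp hENN
  -- (iii) pass to the limit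
  have hev : ∀ n, |∫ x, ⟪f x, ψ n x⟫| ≤ M * (eLpNorm (ψ n) q volume).toReal :=
    fun n => h (ψ n) (hψtop n)
  exact le_of_tendsto_of_tendsto' ((continuous_abs.tendsto _).comp hpair)
    (hnorm.const_mul M) hev
where
  /-- pairings of `L²` fields are integrable -/
  integrable_inner_of_memLp_two {μ : Measure E} {u w : E → E} (hu : MemLp u 2 μ)
      (hw : MemLp w 2 μ) : Integrable (fun x => ⟪u x, w x⟫) μ := by
    have h := L2.integrable_inner (𝕜 := ℝ) (hu.toLp u) (hw.toLp w)
    refine h.congr ?_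
    filter_upwards [hu.coeFn_toLp, hw.coeFn_toLp] with x hx hy
    rw [hx, hy]


omit [InnerProductSpace ℝ E] [FiniteDimensional ℝ E] [BorelSpace E] in
/-- The cube of the `L³` seminorm as a real integral over a set where the integrand is bounded:
bookkeeping between `∫⁻ ‖f‖ₑ³` and `∫ ‖f‖³`. [folklore] -/
theorem lintegral_enorm_pow_three_eq_ofReal {μ : Measure E} {f : E → E} {K : Set E}
    (hint : IntegrableOn (fun x => ‖f x‖ ^ 3) K μ) :
    ∫⁻ x in K, ‖f x‖ₑ ^ (3 : ℕ) ∂μ = ENNReal.ofReal (∫ x in K, ‖f x‖ ^ 3 ∂μ) := by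
  rw [ofReal_integral_eq_lintegral_ofReal hint (Eventually.of_forall fun x => by positivity)]
  refine lintegral_congr fun x => ?_
  rw [← ofReal_norm, ← ENNReal.ofReal_pow (norm_nonneg _)]

/-- **`L³` membership by duality against test fields.** Let `f : E → E` be measurable with
`|f|²` locally integrable (`f ∈ L²_loc`), and suppose that for some `M ≥ 0` every smooth compactly
supported field `φ` satisfies `|∫ ⟪f, φ⟫| ≤ M ‖φ‖_{L^{3/2}}`. Then `f ∈ L³` and `‖f‖_{L³} ≤ M`.
(Extend the bound to compactly supported `L²` fields, `abs_integral_inner_le_of_test_bound`; test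
with `φ = |g| g` for the truncations `g = 𝟙_{K_k} f`, `K_k = {|x| ≤ k, |f(x)| ≤ k}`, for which
`∫ ⟪f, φ⟫ = ∫_{K_k} |f|³ = ‖φ‖_{3/2}^{3/2}`, whence `∫_{K_k} |f|³ ≤ M³`; monotone convergence.
This is the elementary half of the duality `L³ = (L^{3/2})'`, Brezis 2011, Thm. 4.11 /
Prop. 3.5 (iii), as used by Lemarié-Rieusset 2016, p. 573: a distributional limit of fields with
`‖·‖₃ ≤ M` lies in `L³`.) [folklore] -/
theorem memLp_three_of_forall_abs_integral_inner_le {f : E → E}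
    (hfm : AEStronglyMeasurable f volume)
    (hf2 : LocallyIntegrable (fun x => ‖f x‖ ^ 2) volume) {M : ℝ} (hM : 0 ≤ M)
    (h : ∀ φ : E → E, IsTestFunctionOn (⊤ : Opens E) φ →
      |∫ x, ⟪f x, φ x⟫| ≤ M * (eLpNorm φ (3 / 2 : ℝ≥0∞) volume).toReal) :
    MemLp f 3 volume ∧ eLpNorm f 3 volume ≤ ENNReal.ofReal M := by
  set q : ℝ≥0∞ := 3 / 2 with hq_def
  have hqr : q.toReal = 3 / 2 := by rw [hq_def, ENNReal.toReal_div]; norm_num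
  have hq0 : q ≠ 0 := by rw [hq_def]; exact (ENNReal.div_pos (by norm_num) (by norm_num)).ne'
  have hqtop : q ≠ ∞ := by rw [hq_def]; exact ENNReal.div_ne_top (by norm_num) (by norm_num)
  -- ### reduction to a strongly measurable representative
  set g := hfm.mk f with hg_def
  have hgm : StronglyMeasurable g := hfm.stronglyMeasurable_mk
  have hfg : f =ᵐ[volume] g := hfm.ae_eq_mk
  have hg2 : LocallyIntegrable (fun x => ‖g x‖ ^ 2) volume :=
    hf2.congr (hfg.mono fun x hx => by simp [hx])
  have hg : ∀ φ : E → E, IsTestFunctionOn (⊤ : Opens E) φ →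
      |∫ x, ⟪g x, φ x⟫| ≤ M * (eLpNorm φ q volume).toReal := by
    intro φ hφ
    rw [← integral_congr_ae (show (fun x => ⟪f x, φ x⟫) =ᵐ[volume] (fun x => ⟪g x, φ x⟫) from
      hfg.mono fun x hx => by simp only [hx])]
    exact h φ hφ
  suffices hmain : ∫⁻ x, ‖g x‖ₑ ^ (3 : ℕ) ≤ ENNReal.ofReal (M ^ 3) by
    have hlint : ∫⁻ x, ‖f x‖ₑ ^ (3 : ℕ) ≤ ENNReal.ofReal (M ^ 3) := by
      rw [lintegral_congr_ae (show (fun x => ‖f x‖ₑ ^ (3 : ℕ)) =ᵐ[volume]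
        (fun x => ‖g x‖ₑ ^ (3 : ℕ)) from hfg.mono fun x hx => by simp only [hx])]
      exact hmain
    have heq : eLpNorm f 3 volume = (∫⁻ x, ‖f x‖ₑ ^ (3 : ℕ)) ^ (1 / (3 : ℝ)) := by
      rw [eLpNorm_eq_lintegral_rpow_enorm_toReal (by norm_num) (by norm_num)]
      simp only [ENNReal.toReal_ofNat, one_div]
      congr 1
      exact lintegral_congr fun x => by rw [← ENNReal.rpow_natCast]; norm_num
    have hle : eLpNorm f 3 volume ≤ ENNReal.ofReal M := by
      rw [heq]
      calc (∫⁻ x, ‖f x‖ₑ ^ (3 : ℕ)) ^ (1 / (3 : ℝ))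
          ≤ (ENNReal.ofReal (M ^ 3)) ^ (1 / (3 : ℝ)) := by gcongr
        _ = ENNReal.ofReal M := by
          rw [ENNReal.ofReal_rpow_of_nonneg (by positivity) (by norm_num),
            show (M ^ 3 : ℝ) = M ^ ((3 : ℕ) : ℝ) by rw [Real.rpow_natCast], ← Real.rpow_mul hM]
          norm_num
    exact ⟨⟨hfm, hle.trans_lt ENNReal.ofReal_lt_top⟩, hle⟩
  -- ### the truncations `K k = {|x| ≤ k, |g x| ≤ k}`
  set K : ℕ → Set E := fun k => closedBall (0 : E) k ∩ {x | ‖g x‖ ≤ k} with hK_def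
  have hKm : ∀ k, MeasurableSet (K k) := fun k =>
    measurableSet_closedBall.inter (measurableSet_le hgm.norm.measurable measurable_const)
  have hKmono : Monotone K := by
    intro k l hkl x hx
    exact ⟨closedBall_subset_closedBall (by exact_mod_cast hkl) hx.1,
      show ‖g x‖ ≤ (l : ℝ) from hx.2.trans (Nat.cast_le.2 hkl)⟩
  have hKfin : ∀ k, volume (K k) < ∞ := fun k =>
    (measure_mono inter_subset_left).trans_lt measure_closedBall_lt_top
  have hgK : ∀ k, ∀ x ∈ K k, ‖g x‖ ≤ k := fun k x hx => hx.2
  -- `|g|³` is integrable on `K k`, with integral `I k`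
  have hint3 : ∀ k, IntegrableOn (fun x => ‖g x‖ ^ 3) (K k) volume := by
    intro k
    haveI : IsFiniteMeasure (volume.restrict (K k)) := ⟨by
      rw [Measure.restrict_apply_univ]; exact hKfin k⟩
    refine Integrable.mono' (integrable_const ((k : ℝ) ^ 3))
      ((hgm.norm.measurable.pow_const 3).aestronglyMeasurable) ?_
    rw [ae_restrict_iff' (hKm k)]
    refine Eventually.of_forall fun x hx => ?_
    rw [Real.norm_eq_abs, abs_of_nonneg (by positivity)]
    exact pow_le_pow_left₀ (norm_nonneg _) (hgK k x hx) 3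
  set I : ℕ → ℝ := fun k => ∫ x in K k, ‖g x‖ ^ 3 with hI_def
  have hI0 : ∀ k, 0 ≤ I k := fun k => setIntegral_nonneg (hKm k) fun x _ => by positivity
  -- ### the test field `φ k = 𝟙_{K k} |g| g`
  set φ : ℕ → E → E := fun k => (K k).indicator fun x => ‖g x‖ • g x with hφ_def
  have hφk : ∀ k, φ k = (K k).indicator fun x => ‖g x‖ • g x := fun k => rfl
  have hφsupp : ∀ k, support (φ k) ⊆ ball (0 : E) (k + 1) := fun k =>
    (support_indicator_subset).trans (inter_subset_left.trans
      (closedBall_subset_ball (by linarith)))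
  have hφ2 : ∀ k, MemLp (φ k) 2 volume := by
    intro k
    rw [hφk k, memLp_indicator_iff_restrict (hKm k)]
    haveI : IsFiniteMeasure (volume.restrict (K k)) := ⟨by
      rw [Measure.restrict_apply_univ]; exact hKfin k⟩
    refine MemLp.of_bound ((hgm.norm.smul hgm).aestronglyMeasurable) ((k : ℝ) ^ 2) ?_
    rw [ae_restrict_iff' (hKm k)]
    refine Eventually.of_forall fun x hx => ?_
    rw [norm_smul, Real.norm_eq_abs, abs_of_nonneg (norm_nonneg _), sq]
    exact mul_le_mul (hgK k x hx) (hgK k x hx) (norm_nonneg _) (Nat.cast_nonneg _)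
  -- its pairing with `g` is `I k`
  have hpair : ∀ k, ∫ x, ⟪g x, φ k x⟫ = I k := by
    intro k
    have e : (fun x => ⟪g x, φ k x⟫) = (K k).indicator fun x => ‖g x‖ ^ 3 := by
      funext x
      by_cases hx : x ∈ K k
      · rw [hφk k, indicator_of_mem hx, indicator_of_mem hx, inner_smul_right,
          real_inner_self_eq_norm_sq]
        ring
      · rw [hφk k, indicator_of_notMem hx, indicator_of_notMem hx, inner_zero_right]
    rw [e, integral_indicator (hKm k)]
  -- its `L^{3/2}` norm is `(I k)^{2/3}`
  have hφq : ∀ k, (eLpNorm (φ k) q volume).toReal = (I k) ^ (2 / 3 : ℝ) := by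
    intro k
    have h1 : ∫⁻ x, ‖φ k x‖ₑ ^ q.toReal = ∫⁻ x in K k, ‖g x‖ₑ ^ (3 : ℕ) := by
      rw [← lintegral_indicator (hKm k)]
      refine lintegral_congr fun x => ?_
      by_cases hx : x ∈ K k
      · rw [indicator_of_mem hx, hφk k, indicator_of_mem hx, hqr, enorm_smul,
          ← ofReal_norm (‖g x‖), Real.norm_eq_abs, abs_of_nonneg (norm_nonneg _),
          ofReal_norm, ← pow_two, ← ENNReal.rpow_natCast, ← ENNReal.rpow_natCast,
          ← ENNReal.rpow_mul]
        norm_num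
      · rw [indicator_of_notMem hx, hφk k, indicator_of_notMem hx, enorm_zero,
          ENNReal.zero_rpow_of_pos (by rw [hqr]; norm_num)]
    rw [eLpNorm_eq_lintegral_rpow_enorm_toReal hq0 hqtop, h1,
      lintegral_enorm_pow_three_eq_ofReal (hint3 k), hqr, ← ENNReal.toReal_rpow,
      ENNReal.toReal_ofReal (hI0 k)]
    norm_num
  -- ### the bound `I k ≤ M³`
  have hIk : ∀ k, I k ≤ M ^ 3 := by
    intro k
    have hb := abs_integral_inner_le_of_test_bound hgm.aestronglyMeasurable hg2 hg (hφ2 k)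
      (hφsupp k)
    rw [hpair k, hφq k, abs_of_nonneg (hI0 k)] at hb
    -- `I ≤ M I^{2/3}` forces `I ≤ M³`
    rcases (hI0 k).eq_or_lt with h0 | hpos
    · rw [← h0]; positivity
    · have h13 : (I k) ^ (1 / 3 : ℝ) ≤ M := by
        have hpow : 0 < (I k) ^ (2 / 3 : ℝ) := Real.rpow_pos_of_pos hpos _
        refine le_of_mul_le_mul_right ?_ hpow
        calc (I k) ^ (1 / 3 : ℝ) * (I k) ^ (2 / 3 : ℝ) = I k := by
              rw [← Real.rpow_add hpos]; norm_num
          _ ≤ M * (I k) ^ (2 / 3 : ℝ) := hb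
      calc I k = ((I k) ^ (1 / 3 : ℝ)) ^ (3 : ℕ) := by
            rw [← Real.rpow_natCast, ← Real.rpow_mul (hI0 k)]; norm_num
        _ ≤ M ^ 3 := pow_le_pow_left₀ (Real.rpow_nonneg (hI0 k) _) h13 3
  have hJk : ∀ k, ∫⁻ x in K k, ‖g x‖ₑ ^ (3 : ℕ) ≤ ENNReal.ofReal (M ^ 3) := fun k => by
    rw [lintegral_enorm_pow_three_eq_ofReal (hint3 k)]
    exact ENNReal.ofReal_le_ofReal (hIk k)
  -- ### monotone convergence
  have hmeas : Measurable fun x => ‖g x‖ₑ ^ (3 : ℕ) := hgm.measurable.enorm.pow_const 3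
  have hsup : (fun x => ‖g x‖ₑ ^ (3 : ℕ)) = fun x => ⨆ k, (K k).indicator (fun x => ‖g x‖ₑ ^ (3 : ℕ)) x := by
    funext x
    obtain ⟨k, hk⟩ := exists_nat_ge (max ‖x‖ ‖g x‖)
    have hxk : x ∈ K k := ⟨mem_closedBall_zero_iff.2 ((le_max_left _ _).trans hk),
      (le_max_right _ _).trans hk⟩
    refine le_antisymm (le_iSup_of_le k (by rw [indicator_of_mem hxk])) (iSup_le fun l => ?_)
    exact indicator_le_self _ _ x
  rw [hsup, lintegral_iSup (fun k => hmeas.indicator (hKm k))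
    (fun k l hkl x => indicator_le_indicator_of_subset (hKmono hkl) (fun _ => bot_le) x)]
  refine iSup_le fun k => ?_
  rw [lintegral_indicator (hKm k)]
  exact hJk k

end Literature.Analysis.FunctionSpaces

end
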